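import Summits.CriticalPhenomena.PercolationContinuityZ3.Theorems.PercAnnulusCrossingIICExponentsMaster
import HarnessLib

/-!
# Intrinsic balls versus boxes for Kesten's IIC: `B_ω(0, D_n - 1) ⊆ C(0) ∩ Λ(n) ⊆ B_ω(0, M_n)` (lane RSW3, p1 gen 15)

builds on p205010 (kernel theorem, internal audit signed; external expert review pending) — not used in this file (deterministic lattice
geometry plus the `ν`-a.s. support facts of gen 5, every `p`, every `d`).

Seat `prim-rsw3-p1` (gen 15); memo `run/shared/lean/prim/rsw3/P1-QM.md` §28.  Helper file for the crux `stmt-CriticalPhenomena-4575`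
chain; no definitions, no sorries.  Notation (all inline, as in gen 14): `D_n = inf_{v ∉ Λ(n)} dist_ω(0,v)` (chemical distance from the
root to `Λ(n)ᶜ`), `V_n = #{z ∈ Λ(n) : 0 ↔ z}` (volume), `I_r = #{z ∈ Λ(r) : dist_ω(0,z) ≤ r}` (intrinsic ball), and NEW — the CHEMICAL
ECCENTRICITY of the box, `M_n = max {dist_ω(0,z) : z ∈ Λ(n), 0 ↔ z}` (a `Finset.sup` of `toNat` distances).  The physicists' relation
`d_f = d_min · d_ℓ` between the fractal, shortest-path and chemical dimensions rests on the sandwich of the Euclidean part of the cluster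
between two INTRINSIC balls; this file proves the sandwich deterministically:

* `mem_box_of_edist_lt_iInf` — a site at chemical distance `< D_n` from `0` lies in `Λ(n)`;
* **`ncard_intrinsic_le_card_filter_of_lt`** — `I_r ≤ V_n` whenever `r < D_n`; **`ncard_intrinsic_chemical_pred_le_card_filter`** — `I_{D_n - 1} ≤ V_n`;
* **`card_filter_openConn_le_ncard_intrinsic_sup`** — `V_n ≤ I_{max n M_n}`;
* **`iInf_edist_le_sup_add_one`** — `D_n ≤ M_n + 1` (the last inner vertex of a geodesic to `Λ(n)ᶜ`);
* **`toNat_edist_succ_le_card_filter_of_openConnIn`**, **`sup_edist_succ_le_card_filter_of_forall_openConnIn`** — if every site of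
  `C(0) ∩ Λ(n)` is joined to `0` INSIDE `Λ(R)` then `M_n + 1 ≤ V_R` (a geodesic of the cluster restricted to `Λ(R)` has distinct vertices,
  all in `Λ(R)` and joined to `0`) — the link between the eccentricity and the GLUING RADIUS of gen 15's `…IICGluingScale`;
* **`iicMeasure_ae_balls_sandwich`** — for every measure with Kesten's IIC limit property (`0 < p`, `d ≥ 1`), `ν`-a.s. at every scale `n`:
  `I_{D_n - 1} ≤ V_n ≤ I_{max n M_n}`, `n ≤ D_n - 1 ≤ M_n`, and `M_n + 1 ≤ V_R` for every gluing radius `R` of `Λ(n)`.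

References: S. Havlin, D. Ben-Avraham, Adv. Phys. 36 (1987) 695–798, §3 (`d_f = d_min d_ℓ`); H. Kesten, PTRF 73 (1986) 369–394;
G. Grimmett, *Percolation* (1999), §8.2.
-/

noncomputable section

namespace Summit.CriticalPhenomena.PercolationContinuityZ3.Theorems.Crossing

open MeasureTheory Filter Topology Literature.Probability.Percolation Literature.Probability.LatticeModels
open Literature.Probability.Percolation.DCT16 Literature.Probability.Percolation.DKT20
open Summit.CriticalPhenomena.PercolationContinuityZ3.Theorems.SurfaceTension
open scoped Literature.Probability.Percolation ENNReal symmDiff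

variable {d : ℕ}

/-! ## The inner ball: `B_ω(0, D_n - 1) ⊆ C(0) ∩ Λ(n)` -/

/-- A site at chemical distance `< D_n = inf_{v ∉ Λ(n)} dist_ω(0,v)` from the root lies in `Λ(n)`. [folklore] -/
theorem mem_box_of_edist_lt_iInf (ω : BondConfig (Site d)) (n : ℕ) {z : Site d}
    (h : (openGraph ω).edist (0 : Site d) z < ⨅ v : {v : Site d // v ∉ box d n}, (openGraph ω).edist (0 : Site d) v.1) :
    z ∈ box d n := by
  by_contra hz
  exact not_le_of_gt h (iInf_le (fun v : {v : Site d // v ∉ box d n} => (openGraph ω).edist (0 : Site d) v.1) ⟨z, hz⟩)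

open Classical in
/-- **`I_r ≤ V_n` for `r < D_n`**: the intrinsic ball of radius `r < D_n` consists of sites of `Λ(n)` joined to `0`. [folklore] -/
theorem ncard_intrinsic_le_card_filter_of_lt (ω : BondConfig (Site d)) {n r : ℕ}
    (hr : ((r : ℕ) : ℕ∞) < ⨅ v : {v : Site d // v ∉ box d n}, (openGraph ω).edist (0 : Site d) v.1) :
    Set.ncard {z : Site d | z ∈ box d r ∧ (openGraph ω).edist (0 : Site d) z ≤ (r : ℕ)} ≤
      ((box d n).filter fun z => ω ∈ (openConn (0 : Site d) z : Set (BondConfig (Site d)))).card := by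
  classical
  rw [ncard_sep_box_eq_card_filter]
  refine Finset.card_le_card fun z hz => ?_
  rw [Finset.mem_filter] at hz ⊢
  exact ⟨mem_box_of_edist_lt_iInf ω n (lt_of_le_of_lt hz.2 hr),
    SimpleGraph.edist_ne_top_iff_reachable.1 (ne_top_of_le_ne_top (ENat.coe_ne_top r) hz.2)⟩

open Classical in
/-- **`I_{D_n - 1} ≤ V_n`** (for finite `D_n ≥ 1`): the intrinsic ball of radius `D_n - 1` lies in `C(0) ∩ Λ(n)`.
[cite: HavlinBenAvraham1987, §3] -/
theorem ncard_intrinsic_chemical_pred_le_card_filter (ω : BondConfig (Site d)) (n : ℕ)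
    (hfin : (⨅ v : {v : Site d // v ∉ box d n}, (openGraph ω).edist (0 : Site d) v.1) ≠ ⊤)
    (h1 : 1 ≤ (⨅ v : {v : Site d // v ∉ box d n}, (openGraph ω).edist (0 : Site d) v.1).toNat) :
    Set.ncard {z : Site d | z ∈ box d ((⨅ v : {v : Site d // v ∉ box d n}, (openGraph ω).edist (0 : Site d) v.1).toNat - 1) ∧
        (openGraph ω).edist (0 : Site d) z ≤
          (((⨅ v : {v : Site d // v ∉ box d n}, (openGraph ω).edist (0 : Site d) v.1).toNat - 1 : ℕ) : ℕ)} ≤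
      ((box d n).filter fun z => ω ∈ (openConn (0 : Site d) z : Set (BondConfig (Site d)))).card := by
  refine ncard_intrinsic_le_card_filter_of_lt ω ?_
  set D := ⨅ v : {v : Site d // v ∉ box d n}, (openGraph ω).edist (0 : Site d) v.1 with hD
  calc (((D.toNat - 1 : ℕ) : ℕ) : ℕ∞) < ((D.toNat : ℕ) : ℕ∞) := by exact_mod_cast (by omega : D.toNat - 1 < D.toNat)
    _ = D := ENat.coe_toNat hfin

/-! ## The outer ball: `C(0) ∩ Λ(n) ⊆ B_ω(0, M_n)` -/

open Classical in
/-- **`V_n ≤ I_{max n M}`** whenever every site of `C(0) ∩ Λ(n)` is within chemical distance `M` of the root. [folklore] -/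
theorem card_filter_openConn_le_ncard_intrinsic (ω : BondConfig (Site d)) {n M : ℕ}
    (h : ∀ z ∈ box d n, ω ∈ (openConn (0 : Site d) z : Set (BondConfig (Site d))) → (openGraph ω).edist (0 : Site d) z ≤ (M : ℕ)) :
    ((box d n).filter fun z => ω ∈ (openConn (0 : Site d) z : Set (BondConfig (Site d)))).card ≤
      Set.ncard {z : Site d | z ∈ box d (max n M) ∧ (openGraph ω).edist (0 : Site d) z ≤ ((max n M : ℕ) : ℕ)} := by
  classical
  rw [ncard_sep_box_eq_card_filter]
  refine Finset.card_le_card fun z hz => ?_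
  rw [Finset.mem_filter] at hz ⊢
  refine ⟨box_mono d (le_max_left n M) hz.1, (h z hz.1 hz.2).trans ?_⟩
  exact_mod_cast le_max_right n M

open Classical in
/-- **`V_n ≤ I_{max n M_n}`** with the chemical eccentricity `M_n = max {dist_ω(0,z) : z ∈ Λ(n), 0 ↔ z}` of the box: the Euclidean part of the
cluster lies in the intrinsic ball of radius `M_n`. [cite: HavlinBenAvraham1987, §3] -/
theorem card_filter_openConn_le_ncard_intrinsic_sup (ω : BondConfig (Site d)) (n : ℕ) :
    ((box d n).filter fun z => ω ∈ (openConn (0 : Site d) z : Set (BondConfig (Site d)))).card ≤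
      Set.ncard {z : Site d | z ∈ box d (max n
          (((box d n).filter fun z => ω ∈ (openConn (0 : Site d) z : Set (BondConfig (Site d)))).sup
            fun z => ((openGraph ω).edist (0 : Site d) z).toNat)) ∧
        (openGraph ω).edist (0 : Site d) z ≤ ((max n
          (((box d n).filter fun z => ω ∈ (openConn (0 : Site d) z : Set (BondConfig (Site d)))).sup
            fun z => ((openGraph ω).edist (0 : Site d) z).toNat) : ℕ) : ℕ)} := by
  classical
  refine card_filter_openConn_le_ncard_intrinsic ω fun z hz hconn => ?_
  have hfin : (openGraph ω).edist (0 : Site d) z ≠ ⊤ := SimpleGraph.edist_ne_top_iff_reachable.2 hconn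
  rw [← ENat.coe_toNat hfin]
  exact_mod_cast Finset.le_sup (f := fun z => ((openGraph ω).edist (0 : Site d) z).toNat) (Finset.mem_filter.2 ⟨hz, hconn⟩)

/-! ## `D_n ≤ M_n + 1` -/

open Classical in
/-- **`D_n ≤ M_n + 1`**: if `D_n` is finite and positive, the vertex preceding the endpoint of a geodesic from `0` to `Λ(n)ᶜ` is a site of
`C(0) ∩ Λ(n)` at chemical distance `≥ D_n - 1`. [folklore] -/
theorem iInf_edist_le_sup_add_one (ω : BondConfig (Site d)) (n : ℕ)
    (hfin : (⨅ v : {v : Site d // v ∉ box d n}, (openGraph ω).edist (0 : Site d) v.1) ≠ ⊤) :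
    (⨅ v : {v : Site d // v ∉ box d n}, (openGraph ω).edist (0 : Site d) v.1).toNat ≤
      (((box d n).filter fun z => ω ∈ (openConn (0 : Site d) z : Set (BondConfig (Site d)))).sup
        fun z => ((openGraph ω).edist (0 : Site d) z).toNat) + 1 := by
  classical
  set D := ⨅ v : {v : Site d // v ∉ box d n}, (openGraph ω).edist (0 : Site d) v.1 with hD
  haveI hne : Nonempty {v : Site d // v ∉ box d n} := by
    by_contra h
    rw [not_nonempty_iff] at h
    exact hfin (iInf_of_empty _)
  obtain ⟨⟨v, hv⟩, hvD⟩ := exists_eq_iInf_enat (fun v : {v : Site d // v ∉ box d n} => (openGraph ω).edist (0 : Site d) v.1)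
  have hvD' : (openGraph ω).edist 0 v = D := hvD
  have hreach : (openGraph ω).Reachable 0 v := SimpleGraph.edist_ne_top_iff_reachable.1 (by rwa [hvD'])
  obtain ⟨p, hpath, hlen⟩ := hreach.exists_path_of_dist
  have hlenD : ((p.length : ℕ) : ℕ∞) = D := by rw [hlen, hreach.coe_dist_eq_edist, hvD']
  have hDnat : D.toNat = p.length := by rw [← hlenD, ENat.toNat_coe]
  rw [hDnat]
  -- `p.length ≥ 1` since `v ∉ Λ(n) ∋ 0`
  rcases Nat.eq_zero_or_pos p.length with h0 | hpos
  · rw [h0]; exact Nat.zero_le _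
  -- the vertex before the endpoint
  set u := p.getVert (p.length - 1) with hu
  have hadj : (openGraph ω).Adj u (p.getVert (p.length - 1 + 1)) := p.adj_getVert_succ (by omega)
  rw [show p.length - 1 + 1 = p.length by omega, SimpleGraph.Walk.getVert_length] at hadj
  -- `dist(0,u) ≤ length - 1`, hence `u ∈ Λ(n)`; and `dist(0,u) ≥ length - 1` by the triangle inequality
  have hule : (openGraph ω).edist 0 u ≤ ((p.length - 1 : ℕ) : ℕ∞) := by
    calc (openGraph ω).edist 0 u ≤ (p.take (p.length - 1)).length := SimpleGraph.Walk.edist_le _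
      _ ≤ ((p.length - 1 : ℕ) : ℕ∞) := by rw [SimpleGraph.Walk.take_length]; exact_mod_cast min_le_left _ _
  have hubox : u ∈ box d n := by
    refine mem_box_of_edist_lt_iInf ω n (lt_of_le_of_lt hule ?_)
    rw [← hD, ← hlenD]
    exact_mod_cast (by omega : p.length - 1 < p.length)
  have huconn : ω ∈ (openConn (0 : Site d) u : Set (BondConfig (Site d))) := (p.take (p.length - 1)).reachable
  have huge : ((p.length - 1 : ℕ) : ℕ∞) ≤ (openGraph ω).edist 0 u := by
    have htri : (openGraph ω).edist 0 v ≤ (openGraph ω).edist 0 u + (openGraph ω).edist u v := SimpleGraph.edist_triangle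
    rw [SimpleGraph.edist_eq_one_iff_adj.2 hadj, hvD', ← hlenD] at htri
    have hufin : (openGraph ω).edist 0 u ≠ ⊤ := SimpleGraph.edist_ne_top_iff_reachable.2 huconn
    rw [← ENat.coe_toNat hufin] at htri ⊢
    have h' : p.length ≤ ((openGraph ω).edist 0 u).toNat + 1 := by exact_mod_cast htri
    exact_mod_cast (by omega : p.length - 1 ≤ ((openGraph ω).edist 0 u).toNat)
  have hutoNat : p.length - 1 ≤ ((openGraph ω).edist 0 u).toNat := by
    have hufin : (openGraph ω).edist 0 u ≠ ⊤ := SimpleGraph.edist_ne_top_iff_reachable.2 huconn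
    rw [← ENat.coe_toNat hufin] at huge
    exact_mod_cast huge
  have hsup : ((openGraph ω).edist 0 u).toNat ≤ ((box d n).filter fun z =>
      ω ∈ (openConn (0 : Site d) z : Set (BondConfig (Site d)))).sup fun z => ((openGraph ω).edist (0 : Site d) z).toNat :=
    Finset.le_sup (f := fun z => ((openGraph ω).edist (0 : Site d) z).toNat) (Finset.mem_filter.2 ⟨hubox, huconn⟩)
  omega

/-! ## Gluing inside `Λ(R)` bounds the eccentricity by the volume: `M_n + 1 ≤ V_R` -/

open Classical in
/-- If `0 ↔ z` inside `Λ(R)`, then `dist_ω(0,z) + 1 ≤ V_R`: a geodesic of the open graph restricted to `Λ(R)` has pairwise distinct vertices,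
all in `Λ(R)` and joined to `0`. [folklore] -/
theorem toNat_edist_succ_le_card_filter_of_openConnIn (ω : BondConfig (Site d)) {R : ℕ} {z : Site d}
    (h : ω ∈ openConnIn (↑(box d R) : Set (Site d)) (0 : Site d) z) :
    ((openGraph ω).edist (0 : Site d) z).toNat + 1 ≤
      ((box d R).filter fun w => ω ∈ (openConn (0 : Site d) w : Set (BondConfig (Site d)))).card := by
  classical
  obtain ⟨h0, hz, hreach⟩ := h
  obtain ⟨q, hqpath, hqlen⟩ := hreach.exists_path_of_dist
  -- map the geodesic of the induced graph into the open graph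
  have hfinj : Function.Injective (SimpleGraph.Embedding.induce (G := openGraph ω) (↑(box d R) : Set (Site d))).toHom :=
    (SimpleGraph.Embedding.induce (G := openGraph ω) (↑(box d R) : Set (Site d))).injective
  obtain ⟨p, hppath, hplen, hin⟩ : ∃ p : (openGraph ω).Walk (0 : Site d) z, p.IsPath ∧ p.length = q.length ∧
      ∀ i, p.getVert i ∈ box d R := by
    refine ⟨(q.map (SimpleGraph.Embedding.induce (G := openGraph ω) (↑(box d R) : Set (Site d))).toHom).copy rfl rfl,
      (SimpleGraph.Walk.isPath_copy _ _ _).2 (hqpath.map hfinj), ?_, fun i => ?_⟩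
    · rw [SimpleGraph.Walk.length_copy, SimpleGraph.Walk.length_map]
    · rw [SimpleGraph.Walk.getVert_copy, SimpleGraph.Walk.getVert_map]
      exact Finset.mem_coe.1 (q.getVert i).2
  -- `dist_ω(0,z) ≤ q.length`
  have hdist : ((openGraph ω).edist (0 : Site d) z).toNat ≤ q.length := by
    have h1 : (openGraph ω).edist (0 : Site d) z ≤ (q.length : ℕ∞) := by
      rw [← hplen]; exact SimpleGraph.Walk.edist_le p
    have hfin : (openGraph ω).edist (0 : Site d) z ≠ ⊤ := ne_top_of_le_ne_top (ENat.coe_ne_top _) h1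
    rw [← ENat.coe_toNat hfin] at h1
    exact_mod_cast h1
  -- the `q.length + 1` vertices of `p` are distinct, in `Λ(R)`, joined to `0`
  have hconn : ∀ i, ω ∈ (openConn (0 : Site d) (p.getVert i) : Set (BondConfig (Site d))) := fun i => (p.take i).reachable
  calc ((openGraph ω).edist (0 : Site d) z).toNat + 1 ≤ q.length + 1 := by omega
    _ = (Finset.range (q.length + 1)).card := (Finset.card_range _).symm
    _ = ((Finset.range (q.length + 1)).image p.getVert).card := by
        refine (Finset.card_image_of_injOn fun i hi j hj hij => hppath.getVert_injOn ?_ ?_ hij).symm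
        · have := Finset.mem_range.1 (Finset.mem_coe.1 hi); exact Set.mem_setOf.2 (by omega)
        · have := Finset.mem_range.1 (Finset.mem_coe.1 hj); exact Set.mem_setOf.2 (by omega)
    _ ≤ _ := Finset.card_le_card fun w hw => by
        obtain ⟨i, -, rfl⟩ := Finset.mem_image.1 hw
        exact Finset.mem_filter.2 ⟨hin i, hconn i⟩

open Classical in
/-- **`M_n + 1 ≤ V_R` when `C(0) ∩ Λ(n)` is glued inside `Λ(R)`**: if every site of `Λ(n)` joined to `0` is joined to `0` inside `Λ(R)`, the
chemical eccentricity of `Λ(n)` is less than the volume `V_R`. [cite: HavlinBenAvraham1987, §3] -/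
theorem sup_edist_succ_le_card_filter_of_forall_openConnIn (ω : BondConfig (Site d)) {n R : ℕ}
    (h : ∀ z ∈ box d n, ω ∈ (openConn (0 : Site d) z : Set (BondConfig (Site d))) →
      ω ∈ openConnIn (↑(box d R) : Set (Site d)) (0 : Site d) z) :
    (((box d n).filter fun z => ω ∈ (openConn (0 : Site d) z : Set (BondConfig (Site d)))).sup
        fun z => ((openGraph ω).edist (0 : Site d) z).toNat) + 1 ≤
      ((box d R).filter fun w => ω ∈ (openConn (0 : Site d) w : Set (BondConfig (Site d)))).card := by
  classical
  -- `0` itself is glued inside `Λ(R)`, so `V_R ≥ 1`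
  have h0 : ((openGraph ω).edist (0 : Site d) 0).toNat + 1 ≤
      ((box d R).filter fun w => ω ∈ (openConn (0 : Site d) w : Set (BondConfig (Site d)))).card :=
    toNat_edist_succ_le_card_filter_of_openConnIn ω (h 0 (zero_mem_box d n) (SimpleGraph.Reachable.refl _))
  rw [Nat.add_one_le_iff]
  refine (Finset.sup_lt_iff (by rw [bot_eq_zero]; omega)).2 fun z hz => ?_
  obtain ⟨hzbox, hzconn⟩ := Finset.mem_filter.1 hz
  have := toNat_edist_succ_le_card_filter_of_openConnIn ω (h z hzbox hzconn)
  omega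

/-! ## The sandwich for Kesten's IIC, almost surely -/

open Classical in
/-- **THE BALLS SANDWICH FOR KESTEN'S IIC, `ν`-a.s. at every scale** (`d ≥ 1`, `0 < p`; `ν` any measure with Kesten's IIC limit property):
`I_{D_n - 1} ≤ V_n ≤ I_{max n M_n}`, `n ≤ D_n - 1 ≤ M_n`, and `M_n + 1 ≤ V_R` for every radius `R` inside which `C(0) ∩ Λ(n)` is glued to `0`.
[cite: Kesten1986, Thm. (3)] [cite: HavlinBenAvraham1987, §3] -/
theorem iicMeasure_ae_balls_sandwich (hd : 1 ≤ d) (p : unitInterval) (hp : 0 < (p : ℝ))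
    {ν : Measure (BondConfig (Site d))} [IsProbabilityMeasure ν]
    (hν : ∀ (F : Finset (Sym2 (Site d))) (E : Set (BondConfig (Site d))), MeasurableSet E → DeterminedBy E ↑F →
      Tendsto (fun n : ℕ => (bondPercolation (zdGraph d) p).real (E ∩ siteToBoundary d n) / oneArmProb d p n)
        atTop (𝓝 (ν.real E))) :
    ∀ᵐ ω ∂ν, ∀ n : ℕ,
      Set.ncard {z : Site d | z ∈ box d ((⨅ v : {v : Site d // v ∉ box d n}, (openGraph ω).edist (0 : Site d) v.1).toNat - 1) ∧
          (openGraph ω).edist (0 : Site d) z ≤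
            (((⨅ v : {v : Site d // v ∉ box d n}, (openGraph ω).edist (0 : Site d) v.1).toNat - 1 : ℕ) : ℕ)} ≤
        ((box d n).filter fun z => ω ∈ (openConn (0 : Site d) z : Set (BondConfig (Site d)))).card ∧
      ((box d n).filter fun z => ω ∈ (openConn (0 : Site d) z : Set (BondConfig (Site d)))).card ≤
        Set.ncard {z : Site d | z ∈ box d (max n
            (((box d n).filter fun z => ω ∈ (openConn (0 : Site d) z : Set (BondConfig (Site d)))).sup
              fun z => ((openGraph ω).edist (0 : Site d) z).toNat)) ∧
          (openGraph ω).edist (0 : Site d) z ≤ ((max n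
            (((box d n).filter fun z => ω ∈ (openConn (0 : Site d) z : Set (BondConfig (Site d)))).sup
              fun z => ((openGraph ω).edist (0 : Site d) z).toNat) : ℕ) : ℕ)} ∧
      n ≤ (⨅ v : {v : Site d // v ∉ box d n}, (openGraph ω).edist (0 : Site d) v.1).toNat - 1 ∧
      (⨅ v : {v : Site d // v ∉ box d n}, (openGraph ω).edist (0 : Site d) v.1).toNat - 1 ≤
        (((box d n).filter fun z => ω ∈ (openConn (0 : Site d) z : Set (BondConfig (Site d)))).sup
          fun z => ((openGraph ω).edist (0 : Site d) z).toNat) ∧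
      ∀ R : ℕ, (∀ z ∈ box d n, ω ∈ (openConn (0 : Site d) z : Set (BondConfig (Site d))) →
          ω ∈ openConnIn (↑(box d R) : Set (Site d)) (0 : Site d) z) →
        (((box d n).filter fun z => ω ∈ (openConn (0 : Site d) z : Set (BondConfig (Site d)))).sup
            fun z => ((openGraph ω).edist (0 : Site d) z).toNat) + 1 ≤
          ((box d R).filter fun w => ω ∈ (openConn (0 : Site d) w : Set (BondConfig (Site d)))).card := by
  filter_upwards [iicMeasure_ae_succ_le_chemical_ne_top hd p hp hν] with ω hω n
  obtain ⟨hle, hne⟩ := hω n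
  have hD1 : n + 1 ≤ (⨅ v : {v : Site d // v ∉ box d n}, (openGraph ω).edist (0 : Site d) v.1).toNat := by
    have h := ENat.toNat_le_toNat hle hne
    rwa [show (((n + 1 : ℕ) : ℕ∞)).toNat = n + 1 from ENat.toNat_coe _] at h
  have hDM := iInf_edist_le_sup_add_one ω n hne
  refine ⟨ncard_intrinsic_chemical_pred_le_card_filter ω n hne (by omega), card_filter_openConn_le_ncard_intrinsic_sup ω n,
    by omega, by omega, fun R hR => sup_edist_succ_le_card_filter_of_forall_openConnIn ω hR⟩

end Summit.CriticalPhenomena.PercolationContinuityZ3.Theorems.Crossing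

end
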